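import Mathlib
import HarnessLib
import Summits.AnomalousDissipation.AnomalousDissipation.Theses.DecimationAxis
import Literature.Analysis.FluidPDE.GalerkinFlow
import Literature.Analysis.FluidPDE.LongTimeAverageShift
import Literature.Analysis.FluidPDE.TimeAverageMeasureBasic

/-!
# Stub plan companion: `stub_uniformSettling` (crux `DecimationAxis.UniformEquilibration`)

Stub-critic companion to `STUB-PLAN-stub_uniformSettling.md` (unit
`scrit-stmt-AnomalousDissipation-1583-stub_uniformSe`). Everything here is kernel-checked and
sorry-free; it is SCRATCH (crux workfile), not a Theorems file. Contents:

* §0 the skeleton vocabulary and the registered signature `Sig.stub_uniformSettling`, verbatim;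
* §1 bookkeeping (copied with attribution from `STUB_PLAN_stub_absorbedWitness.lean` §4);
* §2 de-junk: `limsup`/`liminf` of time means of a bounded signal ⇒ eventual linear bounds on the
  primitive (k1 A1, k2 H0a/H1a, k3 S1 — the three ideators' common first step);
* §3 F. Riesz rising-sun / setting-sun selection (k1 A2, k2 H1b, k3 S1/S2) and the derived
  "sunrise instant from a `liminf` floor" / "sunset instant from a `limsup` budget";
* §4 the gap arithmetic `settle_of_gap` (k1 A3 with the degenerate cases handled);
* §5 the RESIDUAL in normal form, `UniformSunriseGap` (k1 R1 corrected: no `0 ≤ b` clause; the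
  existential-witness form, not k2 ResidueA / k3 UniformWaitingTime), and the kernel-checked
  reduction `stub_uniformSettling_of_gap : UniformSunriseGap → Sig.stub_uniformSettling`;
* §6 rungs: `settlingBody_of_energySlack` (k2 R1 = k3 A(i), PROVED: the stub's body whenever the
  ball already sits below `2E`), and typed statements of the two honest regime rungs
  (steady-limit / energy-stable, k1 C3 = k3 L1–L2) and of the quiet-phase floor (k3 Q3).
-/

noncomputable section

namespace Summit.AnomalousDissipation.AnomalousDissipation.Cruxes.UniformEquilibration.StubPlanSettling

open scoped BigOperators Topology Classical MeasureTheory InnerProductSpace ComplexConjugate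
open Filter Set Function MeasureTheory
open Literature.Analysis.FunctionSpaces Literature.Analysis.FunctionSpaces.Torus
open Literature.Analysis.FluidPDE
open Summit.AnomalousDissipation.AnomalousDissipation.Theses.DecimationAxis

/-- Integer frequencies (local notation). -/
local notation "ℤ³" => Fin 3 → ℤ
/-- Complex Fourier coefficient vectors (local notation). -/
local notation "ℂ³" => EuclideanSpace ℂ (Fin 3)

/-! ### §0 Vocabulary (verbatim from `Lines/birth.lean`) -/

/-- The crux's solution notion (verbatim copy of the skeleton's `IsCoeffTrajectory`). -/
def IsCoeffTrajectory (S : Finset ℤ³) (ν : ℝ) (g : ℤ³ → ℂ³) (c : ℝ → ↥S → ℂ³) : Prop :=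
  (∀ t, c t ∈ galerkinSubspace S) ∧ ContinuousOn c (Set.Ici 0) ∧
    ∀ T : ℝ, ∀ t ∈ Set.Icc (0 : ℝ) T,
      HasDerivWithinAt c (galerkinRHS S ν (fun k => g k) (c t)) (Set.Icc 0 T) t

/-- Modal energy (verbatim copy). -/
def modalEnergy {S : Finset ℤ³} (a : ↥S → ℂ³) : ℝ :=
  ∑ k : ↥S, ‖a k‖ ^ 2

/-- Resolved dissipation (verbatim copy). -/
def resolvedDissipation {S : Finset ℤ³} (ν : ℝ) (M : ℕ) (a : ↥S → ℂ³) : ℝ :=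
  ν * (4 * Real.pi ^ 2 * ∑ k : ↥S,
    if freqNormSq (k : ℤ³) ≤ (M : ℝ) ^ 2 then freqNormSq (k : ℤ³) * ‖a k‖ ^ 2 else 0)

/-- The premise shared by the stub and the residual: a witness in the ball of radius `B` with the
Floor budgets in `limsup`/`liminf` form (abbreviation; unfolds by `Iff.rfl`). -/
def Premise (ν : ℝ) (g : ℤ³ → ℂ³) (E ε : ℝ) (M : ℕ) (B : ℝ) (S : Finset ℤ³) : Prop :=
  ∃ c : ℝ → ↥S → ℂ³, IsCoeffTrajectory S ν g c ∧ (∀ t, 0 ≤ t → modalEnergy (c t) ≤ B) ∧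
    longTimeAvgSup (fun t => modalEnergy (c t)) ≤ E ∧
    2 * ε ≤ longTimeAvgInf (fun t => resolvedDissipation ν M (c t))

/-- The stub's body at fixed data `(ν, g, E, ε, M, B)` (abbreviation; unfolds by `Iff.rfl`). -/
def SettlingBody (ν : ℝ) (g : ℤ³ → ℂ³) (E ε : ℝ) (M : ℕ) (B : ℝ) : Prop :=
  ∃ (T₁ E₁ ε₁ B₁ : ℝ), E₁ < 2 * E ∧ ε < ε₁ ∧
    ∀ (K : ℕ) (S : Finset ℤ³), S = (freqBall K).erase 0 →
      Premise ν g E ε M B S →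
      ∃ c : ℝ → ↥S → ℂ³, IsCoeffTrajectory S ν g c ∧ (∀ t, 0 ≤ t → modalEnergy (c t) ≤ B₁) ∧
          ∀ T : ℝ, T₁ ≤ T →
            timeMean (fun t => modalEnergy (c t)) T ≤ E₁ ∧
            ε₁ ≤ timeMean (fun t => resolvedDissipation ν M (c t)) T

/-- The registered stub signature (verbatim copy of `Lines/birth.lean`). -/
def Sig.stub_uniformSettling : Prop :=
  ∀ (ν : ℝ), 0 < ν → ∀ (N : ℕ) (g : ℤ³ → ℂ³), IsConjSymm g → (∀ k, k ∉ freqBall N → g k = 0) →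
    g 0 = 0 → (∀ k : ℤ³, ∑ i, ((k i : ℤ) : ℂ) * g k i = 0) →
    ∀ (E ε : ℝ) (M : ℕ) (B : ℝ), 0 < ε →
      ∃ (T₁ E₁ ε₁ B₁ : ℝ), E₁ < 2 * E ∧ ε < ε₁ ∧
        ∀ (K : ℕ) (S : Finset ℤ³), S = (freqBall K).erase 0 →
          (∃ c : ℝ → ↥S → ℂ³, IsCoeffTrajectory S ν g c ∧ (∀ t, 0 ≤ t → modalEnergy (c t) ≤ B) ∧
              longTimeAvgSup (fun t => modalEnergy (c t)) ≤ E ∧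
              2 * ε ≤ longTimeAvgInf (fun t => resolvedDissipation ν M (c t))) →
          ∃ c : ℝ → ↥S → ℂ³, IsCoeffTrajectory S ν g c ∧ (∀ t, 0 ≤ t → modalEnergy (c t) ≤ B₁) ∧
              ∀ T : ℝ, T₁ ≤ T →
                timeMean (fun t => modalEnergy (c t)) T ≤ E₁ ∧
                ε₁ ≤ timeMean (fun t => resolvedDissipation ν M (c t)) T

/-- The stub is "`SettlingBody` at every admissible datum" (definitional). -/
theorem stub_iff_settlingBody :
    Sig.stub_uniformSettling ↔
      ∀ (ν : ℝ), 0 < ν → ∀ (N : ℕ) (g : ℤ³ → ℂ³), IsConjSymm g →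
        (∀ k, k ∉ freqBall N → g k = 0) → g 0 = 0 →
        (∀ k : ℤ³, ∑ i, ((k i : ℤ) : ℂ) * g k i = 0) →
        ∀ (E ε : ℝ) (M : ℕ) (B : ℝ), 0 < ε → SettlingBody ν g E ε M B :=
  Iff.rfl

/-! ### §1 Bookkeeping (copied from `STUB_PLAN_stub_absorbedWitness.lean` §4, sibling critic) -/

/-- The crux's solution notion is `IsGalerkinODESolution` minus the `rfl` datum clause. -/
theorem isCoeffTrajectory_iff {S : Finset ℤ³} {ν : ℝ} {g : ℤ³ → ℂ³} {c : ℝ → ↥S → ℂ³} :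
    IsCoeffTrajectory S ν g c ↔ IsGalerkinODESolution ν (fun k : ↥S => g k) (c 0) c :=
  ⟨fun h => ⟨rfl, h.1, h.2.1, h.2.2⟩, fun h => ⟨h.mem, h.continuousOn, h.hasDerivWithinAt⟩⟩

/-- Autonomy: time shifts of trajectories are trajectories (`IsGalerkinODESolution.comp_add`). -/
theorem IsCoeffTrajectory.comp_add {S : Finset ℤ³} {ν : ℝ} {g : ℤ³ → ℂ³} {c : ℝ → ↥S → ℂ³}
    (hc : IsCoeffTrajectory S ν g c) {s : ℝ} (hs : 0 ≤ s) :
    IsCoeffTrajectory S ν g (fun t => c (t + s)) := by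
  have h := (isCoeffTrajectory_iff.1 hc).comp_add hs
  exact ⟨h.mem, h.continuousOn, h.hasDerivWithinAt⟩

/-- Continuity of the modal energy along a trajectory. -/
theorem continuousOn_modalEnergy {S : Finset ℤ³} {c : ℝ → ↥S → ℂ³} (hc : ContinuousOn c (Ici 0)) :
    ContinuousOn (fun t => modalEnergy (c t)) (Ici 0) := by
  unfold modalEnergy
  refine continuousOn_finsetSum _ fun k _ => ?_
  exact (((continuous_apply k).comp_continuousOn hc).norm).pow 2

/-- Continuity of the resolved dissipation along a trajectory. -/
theorem continuousOn_resolvedDissipation {S : Finset ℤ³} (ν : ℝ) (M : ℕ) {c : ℝ → ↥S → ℂ³}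
    (hc : ContinuousOn c (Ici 0)) :
    ContinuousOn (fun t => resolvedDissipation ν M (c t)) (Ici 0) := by
  unfold resolvedDissipation
  refine continuousOn_const.mul (continuousOn_const.mul (continuousOn_finsetSum _ fun k _ => ?_))
  by_cases hk : freqNormSq (k : ℤ³) ≤ (M : ℝ) ^ 2
  · simp only [if_pos hk]
    exact continuousOn_const.mul ((((continuous_apply k).comp_continuousOn hc).norm).pow 2)
  · simp only [if_neg hk]
    exact continuousOn_const

/-- Nonnegativity of the modal energy. -/
theorem modalEnergy_nonneg {S : Finset ℤ³} (a : ↥S → ℂ³) : 0 ≤ modalEnergy a :=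
  Finset.sum_nonneg fun _ _ => sq_nonneg _

/-- Nonnegativity of the resolved dissipation. -/
theorem resolvedDissipation_nonneg {S : Finset ℤ³} {ν : ℝ} (hν : 0 ≤ ν) (M : ℕ) (a : ↥S → ℂ³) :
    0 ≤ resolvedDissipation ν M a := by
  unfold resolvedDissipation
  refine mul_nonneg hν (mul_nonneg (by positivity) (Finset.sum_nonneg fun k _ => ?_))
  split_ifs
  · exact mul_nonneg (freqNormSq_nonneg _) (sq_nonneg _)
  · exact le_rfl

/-- Resolved dissipation is controlled by `M²` times the energy (K-uniform inside the ball). -/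
theorem resolvedDissipation_le {S : Finset ℤ³} {ν : ℝ} (hν : 0 ≤ ν) (M : ℕ) (a : ↥S → ℂ³) :
    resolvedDissipation ν M a ≤ ν * (4 * Real.pi ^ 2 * ((M : ℝ) ^ 2 * modalEnergy a)) := by
  unfold resolvedDissipation modalEnergy
  refine mul_le_mul_of_nonneg_left (mul_le_mul_of_nonneg_left ?_ (by positivity)) hν
  rw [Finset.mul_sum]
  refine Finset.sum_le_sum fun k _ => ?_
  split_ifs with hk
  · exact mul_le_mul_of_nonneg_right hk (sq_nonneg _)
  · positivity

/-- Interval integrability of a function continuous on `[0, ∞)` over `[a, b] ⊆ [0, ∞)`. -/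
theorem intervalIntegrable_of_continuousOn_Ici {φ : ℝ → ℝ} (hφ : ContinuousOn φ (Ici 0)) {a b : ℝ}
    (ha : 0 ≤ a) (hab : a ≤ b) : IntervalIntegrable φ volume a b :=
  (hφ.mono (by rw [uIcc_of_le hab]; exact fun t ht => ha.trans ht.1)).intervalIntegrable

/-- Same, without the order hypothesis (both endpoints in `[0, ∞)`). -/
theorem intervalIntegrable_of_continuousOn_Ici' {φ : ℝ → ℝ} (hφ : ContinuousOn φ (Ici 0))
    {a b : ℝ} (ha : 0 ≤ a) (hb : 0 ≤ b) : IntervalIntegrable φ volume a b := by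
  rcases le_total a b with hab | hba
  · exact intervalIntegrable_of_continuousOn_Ici hφ ha hab
  · exact (intervalIntegrable_of_continuousOn_Ici hφ hb hba).symm

/-! ### §2 De-junk: eventual linear bounds on the primitive from `limsup` / `liminf` of time means

The time means of a signal bounded on `(0, ∞)` are bounded (tree: `isBoundedUnder_le_timeMean`,
`isBoundedUnder_ge_timeMean`), so `Filter.eventually_lt_of_limsup_lt` /
`Filter.eventually_lt_of_lt_liminf` are not reading junk values. -/

/-- `limsup` budget ⇒ eventually `∫₀ᵘ φ < b·u`. -/
theorem eventually_integral_lt_of_longTimeAvgSup_lt {φ : ℝ → ℝ} {b C : ℝ}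
    (hsup : longTimeAvgSup φ < b) (hbd : ∀ t, 0 < t → |φ t| ≤ C) :
    ∀ᶠ u in atTop, (∫ t in (0 : ℝ)..u, φ t) < b * u := by
  have hev : ∀ᶠ u in atTop, timeMean φ u < b :=
    Filter.eventually_lt_of_limsup_lt hsup (isBoundedUnder_le_timeMean hbd)
  filter_upwards [hev, eventually_gt_atTop 0] with u hu hu0
  unfold timeMean at hu
  rw [inv_mul_lt_iff₀ hu0] at hu
  linarith [mul_comm u b]

/-- `liminf` floor ⇒ eventually `a·u < ∫₀ᵘ φ`. -/
theorem eventually_lt_integral_of_lt_longTimeAvgInf {φ : ℝ → ℝ} {a C : ℝ}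
    (hinf : a < longTimeAvgInf φ) (hbd : ∀ t, 0 < t → |φ t| ≤ C) :
    ∀ᶠ u in atTop, a * u < ∫ t in (0 : ℝ)..u, φ t := by
  have hev : ∀ᶠ u in atTop, a < timeMean φ u :=
    Filter.eventually_lt_of_lt_liminf hinf (isBoundedUnder_ge_timeMean hbd)
  filter_upwards [hev, eventually_gt_atTop 0] with u hu hu0
  unfold timeMean at hu
  rw [lt_inv_mul_iff₀ hu0] at hu
  linarith [mul_comm u a]

/-! ### §3 Rising sun / setting sun (F. Riesz) -/

/-- **Rising-sun selection** (compact form). If `F(u) = ∫₀ᵘ φ - a·u` satisfies `F(t₀) ≤ F(u)`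
for all `u ≥ R`, then a minimiser `s` of `F` on `[t₀, R]` is a SUNRISE INSTANT: every forward
window from `s` has mean `≥ a`, with no waiting time. -/
theorem rising_sun {φ : ℝ → ℝ} {a t₀ R : ℝ} (ht₀ : 0 ≤ t₀) (hR : t₀ ≤ R)
    (hφ : ContinuousOn φ (Ici 0))
    (hev : ∀ u, R ≤ u → (∫ t in (0 : ℝ)..t₀, φ t) - a * t₀ ≤ (∫ t in (0 : ℝ)..u, φ t) - a * u) :
    ∃ s, t₀ ≤ s ∧ s ≤ R ∧ ∀ T, 0 ≤ T → a * T ≤ ∫ t in s..(s + T), φ t := by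
  set F : ℝ → ℝ := fun u => (∫ t in (0 : ℝ)..u, φ t) - a * u with hF
  -- `F` is continuous on `[t₀, R]`
  have hprim : ContinuousOn (fun u => ∫ t in (0 : ℝ)..u, φ t) (Icc t₀ R) := by
    have h := intervalIntegral.continuousOn_primitive_interval' (μ := volume) (f := φ)
      (b₁ := 0) (b₂ := R) (a := 0)
      (intervalIntegrable_of_continuousOn_Ici hφ le_rfl (ht₀.trans hR)) (left_mem_uIcc)
    rw [uIcc_of_le (ht₀.trans hR)] at h
    exact h.mono (Icc_subset_Icc_left ht₀)
  have hFc : ContinuousOn F (Icc t₀ R) := hprim.sub (continuousOn_const.mul continuousOn_id)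
  obtain ⟨s, hs, hmin⟩ :=
    (isCompact_Icc (a := t₀) (b := R)).exists_isMinOn (nonempty_Icc.2 hR) hFc
  refine ⟨s, hs.1, hs.2, fun T hT => ?_⟩
  have hs0 : 0 ≤ s := ht₀.trans hs.1
  -- `F s ≤ F (s + T)` in both cases `s + T ≤ R` / `R ≤ s + T`
  have hkey : F s ≤ F (s + T) := by
    rcases le_total (s + T) R with h | h
    · exact hmin ⟨hs.1.trans (le_add_of_nonneg_right hT), h⟩
    · exact (hmin ⟨le_rfl, hR⟩).trans (hev _ h)
  have hsplit : (∫ t in (0 : ℝ)..(s + T), φ t) - ∫ t in (0 : ℝ)..s, φ t = ∫ t in s..(s + T), φ t :=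
    intervalIntegral.integral_interval_sub_left
      (intervalIntegrable_of_continuousOn_Ici hφ le_rfl (hs0.trans (le_add_of_nonneg_right hT)))
      (intervalIntegrable_of_continuousOn_Ici hφ le_rfl hs0)
  simp only [hF] at hkey
  linarith

/-- **Setting-sun selection**: the mirror image for a `limsup`-type budget. -/
theorem setting_sun {φ : ℝ → ℝ} {b t₀ R : ℝ} (ht₀ : 0 ≤ t₀) (hR : t₀ ≤ R)
    (hφ : ContinuousOn φ (Ici 0))
    (hev : ∀ u, R ≤ u → (∫ t in (0 : ℝ)..u, φ t) - b * u ≤ (∫ t in (0 : ℝ)..t₀, φ t) - b * t₀) :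
    ∃ s, t₀ ≤ s ∧ s ≤ R ∧ ∀ T, 0 ≤ T → ∫ t in s..(s + T), φ t ≤ b * T := by
  obtain ⟨s, hs₁, hs₂, hsun⟩ := rising_sun (φ := fun t => -φ t) (a := -b) ht₀ hR hφ.neg
    (fun u hu => by
      simp only [intervalIntegral.integral_neg]
      linarith [hev u hu])
  refine ⟨s, hs₁, hs₂, fun T hT => ?_⟩
  have h := hsun T hT
  simp only [intervalIntegral.integral_neg] at h
  linarith

/-- **Sunrise instant from a `liminf` floor** (k1 A1+A2, k2 H1a+H1b, k3 S1): if the time means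
of a bounded continuous signal have `liminf > a`, then beyond any `t₀ ≥ 0` there is an instant all
of whose forward windows have mean `≥ a` — the waiting time for ONE observable is removable. -/
theorem exists_sunrise {φ : ℝ → ℝ} {a C t₀ : ℝ} (hφ : ContinuousOn φ (Ici 0))
    (hbd : ∀ t, 0 < t → |φ t| ≤ C) (ha : a < longTimeAvgInf φ) (ht₀ : 0 ≤ t₀) :
    ∃ s, t₀ ≤ s ∧ ∀ T, 0 ≤ T → a * T ≤ ∫ t in s..(s + T), φ t := by
  obtain ⟨a', haa', ha'⟩ := exists_between ha
  obtain ⟨R₀, hR₀⟩ := Filter.eventually_atTop.1 (eventually_lt_integral_of_lt_longTimeAvgInf ha' hbd)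
  set F₀ : ℝ := (∫ t in (0 : ℝ)..t₀, φ t) - a * t₀
  set R : ℝ := max (max R₀ t₀) (F₀ / (a' - a))
  have hgap : 0 < a' - a := sub_pos.2 haa'
  obtain ⟨s, hs, -, hsun⟩ := rising_sun (a := a) ht₀
    ((le_max_right _ _).trans (le_max_left _ _)) hφ (fun u hu => by
      have hu₀ : R₀ ≤ u := ((le_max_left _ _).trans (le_max_left _ _)).trans hu
      have hu₁ : F₀ / (a' - a) ≤ u := (le_max_right _ _).trans hu
      have h1 : a' * u < ∫ t in (0 : ℝ)..u, φ t := hR₀ u hu₀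
      have h2 : F₀ ≤ (a' - a) * u := by rwa [div_le_iff₀ hgap, mul_comm] at hu₁
      show F₀ ≤ _
      nlinarith)
  exact ⟨s, hs, hsun⟩

/-- **Sunset instant from a `limsup` budget** (mirror image). -/
theorem exists_sunset {φ : ℝ → ℝ} {b C t₀ : ℝ} (hφ : ContinuousOn φ (Ici 0))
    (hbd : ∀ t, 0 < t → |φ t| ≤ C) (hb : longTimeAvgSup φ < b) (ht₀ : 0 ≤ t₀) :
    ∃ s, t₀ ≤ s ∧ ∀ T, 0 ≤ T → ∫ t in s..(s + T), φ t ≤ b * T := by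
  obtain ⟨b', hb', hbb'⟩ := exists_between hb
  obtain ⟨R₀, hR₀⟩ := Filter.eventually_atTop.1 (eventually_integral_lt_of_longTimeAvgSup_lt hb' hbd)
  set F₀ : ℝ := (∫ t in (0 : ℝ)..t₀, φ t) - b * t₀
  set R : ℝ := max (max R₀ t₀) (-F₀ / (b - b'))
  have hgap : 0 < b - b' := sub_pos.2 hbb'
  obtain ⟨s, hs, -, hset⟩ := setting_sun (b := b) ht₀
    ((le_max_right _ _).trans (le_max_left _ _)) hφ (fun u hu => by
      have hu₀ : R₀ ≤ u := ((le_max_left _ _).trans (le_max_left _ _)).trans hu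
      have hu₁ : -F₀ / (b - b') ≤ u := (le_max_right _ _).trans hu
      have h1 : (∫ t in (0 : ℝ)..u, φ t) < b' * u := hR₀ u hu₀
      have h2 : -F₀ ≤ (b - b') * u := by rwa [div_le_iff₀ hgap, mul_comm] at hu₁
      show _ ≤ F₀
      nlinarith)
  exact ⟨s, hs, hset⟩

/-! ### §4 Gap arithmetic (k1 A3): a sunrise instant for `D` and a sunset instant for `e` at
distance `≤ Δ` give explicit uniform settling from the earlier of the two -/

/-- Window integrals after a time shift. -/
theorem integral_comp_add_right_zero (φ : ℝ → ℝ) (s T : ℝ) :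
    ∫ t in (0 : ℝ)..T, φ (t + s) = ∫ t in s..(s + T), φ t := by
  rw [intervalIntegral.integral_comp_add_right, zero_add, add_comm T s]

/-- **Settling from a bounded sunrise–sunset gap.** `e, D` continuous on `[0, ∞)`,
`D ≥ 0` and `e ≤ B₁` there; `s_D` a sunrise instant of `D` at level `a`, `s_e` a sunset instant of `e` at
level `b ≥ 0`, `|s_D - s_e| ≤ Δ`. Then from `s := min s_D s_e` every window of length
`T ≥ max 1 (Δ · max (a/(a-ε₁)) (B₁/(E₁-b)))` has `D`-mean `≥ ε₁` and `e`-mean `≤ E₁`. -/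
theorem settle_of_gap {e D : ℝ → ℝ} {a b ε₁ E₁ B₁ Δ sD se : ℝ}
    (he : ContinuousOn e (Ici 0)) (hD : ContinuousOn D (Ici 0))
    (hD0 : ∀ t, 0 ≤ t → 0 ≤ D t) (heB : ∀ t, 0 ≤ t → e t ≤ B₁)
    (hsD : 0 ≤ sD) (hse : 0 ≤ se) (hgap : |sD - se| ≤ Δ)
    (hε₁ : 0 ≤ ε₁) (hε₁a : ε₁ < a) (hb : 0 ≤ b) (hbE : b < E₁)
    (hsun : ∀ T, 0 ≤ T → a * T ≤ ∫ t in sD..(sD + T), D t)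
    (hset : ∀ T, 0 ≤ T → ∫ t in se..(se + T), e t ≤ b * T) :
    ∃ s, 0 ≤ s ∧ ∀ T, max 1 (Δ * max (a / (a - ε₁)) (B₁ / (E₁ - b))) ≤ T →
      timeMean (fun t => e (t + s)) T ≤ E₁ ∧ ε₁ ≤ timeMean (fun t => D (t + s)) T := by
  have hΔ : 0 ≤ Δ := (abs_nonneg _).trans hgap
  have ha : 0 < a := hε₁.trans_lt hε₁a
  have haε : 0 < a - ε₁ := sub_pos.2 hε₁a
  have hEb : 0 < E₁ - b := sub_pos.2 hbE
  refine ⟨min sD se, le_min hsD hse, fun T hT => ?_⟩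
  have hT1 : 1 ≤ T := (le_max_left _ _).trans hT
  have hT0 : 0 < T := one_pos.trans_le hT1
  have hTΔa : Δ * (a / (a - ε₁)) ≤ T :=
    ((mul_le_mul_of_nonneg_left (le_max_left _ _) hΔ).trans (le_max_right _ _)).trans hT
  have hTΔB : Δ * (B₁ / (E₁ - b)) ≤ T :=
    ((mul_le_mul_of_nonneg_left (le_max_right _ _) hΔ).trans (le_max_right _ _)).trans hT
  -- `Δ ≤ T` (since `a/(a-ε₁) ≥ 1`)
  have hΔT : Δ ≤ T := by
    have h1 : 1 ≤ a / (a - ε₁) := by rw [le_div_iff₀ haε]; linarith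
    nlinarith
  -- clear denominators in the two threshold conditions
  have hTa : a * Δ ≤ (a - ε₁) * T := by
    have := mul_le_mul_of_nonneg_left hTΔa haε.le
    rwa [mul_div_assoc', mul_div_cancel₀ _ haε.ne', mul_comm Δ a] at this
    -- fallback handled below if this rewriting fails
  have hTB : B₁ * Δ ≤ (E₁ - b) * T := by
    have := mul_le_mul_of_nonneg_left hTΔB hEb.le
    rwa [mul_div_assoc', mul_div_cancel₀ _ hEb.ne', mul_comm Δ B₁] at this
  -- the means are window integrals
  rw [timeMean, timeMean, integral_comp_add_right_zero, integral_comp_add_right_zero,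
    inv_mul_le_iff₀ hT0, le_inv_mul_iff₀ hT0]
  rcases le_total sD se with hle | hle
  · -- `s = sD`, `δ := se - sD ∈ [0, Δ]`
    rw [min_eq_left hle]
    have hδ : se - sD ≤ Δ := by
      have := neg_abs_le (sD - se); linarith [abs_sub_comm sD se]
    refine ⟨?_, ?_⟩
    · -- energy: split the window at `se`
      have hseT : se ≤ sD + T := by linarith
      have hsplit : ∫ t in sD..(sD + T), e t =
          (∫ t in sD..se, e t) + ∫ t in se..(sD + T), e t :=
        (intervalIntegral.integral_add_adjacent_intervals
          (intervalIntegrable_of_continuousOn_Ici he hsD hle)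
          (intervalIntegrable_of_continuousOn_Ici he hse hseT)).symm
      have h1 : ∫ t in sD..se, e t ≤ B₁ * (se - sD) := by
        have := intervalIntegral.integral_mono_on hle
          (intervalIntegrable_of_continuousOn_Ici he hsD hle) intervalIntegrable_const
          (fun t ht => heB t (hsD.trans ht.1))
        rwa [intervalIntegral.integral_const, smul_eq_mul, mul_comm] at this
      have h2 : ∫ t in se..(sD + T), e t ≤ b * (sD + T - se) := by
        have := hset (sD + T - se) (by linarith)
        rwa [show se + (sD + T - se) = sD + T by ring] at this
      -- `(B₁ - b)·δ ≤ (E₁ - b)·T`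
      rcases le_total B₁ b with hBb | hBb
      · nlinarith
      · nlinarith
    · -- dissipation: the sunrise window itself
      have := hsun T hT0.le
      nlinarith
  · -- `s = se`, `δ := sD - se ∈ [0, Δ]`
    rw [min_eq_right hle]
    have hδ : sD - se ≤ Δ := (le_abs_self _).trans hgap
    refine ⟨?_, ?_⟩
    · -- energy: the sunset window itself
      have := hset T hT0.le
      nlinarith
    · -- dissipation: drop `[se, sD]`, use the sunrise window of length `T - δ`
      have hsDT : sD ≤ se + T := by linarith
      have hsplit : ∫ t in se..(se + T), D t =
          (∫ t in se..sD, D t) + ∫ t in sD..(se + T), D t :=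
        (intervalIntegral.integral_add_adjacent_intervals
          (intervalIntegrable_of_continuousOn_Ici hD hse hle)
          (intervalIntegrable_of_continuousOn_Ici hD hsD hsDT)).symm
      have h1 : 0 ≤ ∫ t in se..sD, D t :=
        intervalIntegral.integral_nonneg hle fun t ht => hD0 t (hse.trans ht.1)
      have h2 : a * (se + T - sD) ≤ ∫ t in sD..(se + T), D t := by
        have := hsun (se + T - sD) (by linarith)
        rwa [show sD + (se + T - sD) = se + T by ring] at this
      nlinarith

/-! ### §5 The residual in normal form and the reduction of the stub to it -/

/-- **The residual (k1 R1, corrected).** Same quantifier prefix as the stub; the conclusion asks,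
for SOME ball trajectory of the truncated system, a sunrise instant `sD` of the resolved
dissipation at a level `a > ε` and a sunset instant `se` of the energy at a level `b < 2E`, at
mutual distance `≤ Δ`, with `(Δ, a, b, B₁)` independent of `K`. No `0 ≤ b` clause (for
`b < 0` the sunset clause is self-contradictory, which the reduction handles); this keeps the
normal form equivalent to the stub also in the degenerate regime `E ≤ 0`. -/
def UniformSunriseGap : Prop :=
  ∀ (ν : ℝ), 0 < ν → ∀ (N : ℕ) (g : ℤ³ → ℂ³), IsConjSymm g → (∀ k, k ∉ freqBall N → g k = 0) →
    g 0 = 0 → (∀ k : ℤ³, ∑ i, ((k i : ℤ) : ℂ) * g k i = 0) →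
    ∀ (E ε : ℝ) (M : ℕ) (B : ℝ), 0 < ε →
      ∃ (Δ a b B₁ : ℝ), ε < a ∧ b < 2 * E ∧
        ∀ (K : ℕ) (S : Finset ℤ³), S = (freqBall K).erase 0 →
          (∃ c : ℝ → ↥S → ℂ³, IsCoeffTrajectory S ν g c ∧ (∀ t, 0 ≤ t → modalEnergy (c t) ≤ B) ∧
              longTimeAvgSup (fun t => modalEnergy (c t)) ≤ E ∧
              2 * ε ≤ longTimeAvgInf (fun t => resolvedDissipation ν M (c t))) →
          ∃ c : ℝ → ↥S → ℂ³, IsCoeffTrajectory S ν g c ∧ (∀ t, 0 ≤ t → modalEnergy (c t) ≤ B₁) ∧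
            ∃ sD se : ℝ, 0 ≤ sD ∧ 0 ≤ se ∧ |sD - se| ≤ Δ ∧
              (∀ T, 0 ≤ T → a * T ≤ ∫ t in sD..(sD + T), resolvedDissipation ν M (c t)) ∧
              (∀ T, 0 ≤ T → ∫ t in se..(se + T), modalEnergy (c t) ≤ b * T)

/-- The residual at fixed data (the inner `∃ (Δ a b B₁) …` block of `UniformSunriseGap`). -/
def GapBody (ν : ℝ) (g : ℤ³ → ℂ³) (E ε : ℝ) (M : ℕ) (B : ℝ) : Prop :=
  ∃ (Δ a b B₁ : ℝ), ε < a ∧ b < 2 * E ∧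
    ∀ (K : ℕ) (S : Finset ℤ³), S = (freqBall K).erase 0 →
      Premise ν g E ε M B S →
      ∃ c : ℝ → ↥S → ℂ³, IsCoeffTrajectory S ν g c ∧ (∀ t, 0 ≤ t → modalEnergy (c t) ≤ B₁) ∧
        ∃ sD se : ℝ, 0 ≤ sD ∧ 0 ≤ se ∧ |sD - se| ≤ Δ ∧
          (∀ T, 0 ≤ T → a * T ≤ ∫ t in sD..(sD + T), resolvedDissipation ν M (c t)) ∧
          (∀ T, 0 ≤ T → ∫ t in se..(se + T), modalEnergy (c t) ≤ b * T)

/-- **Reduction at fixed data**: a bounded sunrise–sunset gap settles the stub's body, with the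
explicit constants `ε₁ := (ε + a)/2`, `E₁ := (b + 2E)/2`,
`T₁ := max 1 (Δ · max (a/(a-ε₁)) (B₁/(E₁-b)))`, output ball `B₁`. -/
theorem settlingBody_of_gapBody {ν : ℝ} (hν : 0 < ν) {g : ℤ³ → ℂ³} {E ε : ℝ} {M : ℕ} {B : ℝ}
    (hε : 0 < ε) (h : GapBody ν g E ε M B) : SettlingBody ν g E ε M B := by
  obtain ⟨Δ, a, b, B₁, ha, hb, H⟩ := h
  set ε₁ : ℝ := (ε + a) / 2 with hε₁
  set E₁ : ℝ := (b + 2 * E) / 2 with hE₁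
  refine ⟨max 1 (Δ * max (a / (a - ε₁)) (B₁ / (E₁ - b))), E₁, ε₁, B₁,
    by simp only [hE₁]; linarith, by simp only [hε₁]; linarith, fun K S hS hprem => ?_⟩
  obtain ⟨c, hc, hball, sD, se, hsD, hse, hgap, hsun, hset⟩ := H K S hS hprem
  have he0 : ∀ t, 0 ≤ t → 0 ≤ modalEnergy (c t) := fun t _ => modalEnergy_nonneg _
  -- `b < 0` is impossible: the unit sunset window would have negative energy integral
  rcases lt_or_ge b 0 with hb0 | hb0
  · exfalso
    have h1 := hset 1 zero_le_one
    have h2 : 0 ≤ ∫ t in se..(se + 1), modalEnergy (c t) :=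
      intervalIntegral.integral_nonneg (by linarith) fun t ht => he0 t (hse.trans ht.1)
    linarith
  have h1 : (0 : ℝ) ≤ ε₁ := by simp only [hε₁]; linarith
  have h2 : ε₁ < a := by simp only [hε₁]; linarith
  have h3 : b < E₁ := by simp only [hE₁]; linarith
  obtain ⟨s, hs0, hsettle⟩ := settle_of_gap (continuousOn_modalEnergy hc.2.1)
    (continuousOn_resolvedDissipation ν M hc.2.1)
    (fun t _ => resolvedDissipation_nonneg hν.le M (c t)) hball hsD hse hgap h1 h2 hb0 h3 hsun hset
  exact ⟨fun t => c (t + s), hc.comp_add hs0, fun t ht => hball (t + s) (by linarith),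
    fun T hT => hsettle T hT⟩

/-- **The stub reduces to the residual** (kernel-checked assembly of the selection half). -/
theorem stub_uniformSettling_of_gap (h : UniformSunriseGap) : Sig.stub_uniformSettling := by
  intro ν hν N g hg hsupp hg0 hdiv E ε M B hε
  exact settlingBody_of_gapBody hν hε (h ν hν N g hg hsupp hg0 hdiv E ε M B hε)

/-- **Converse at fixed data**: a settled trajectory carries a sunrise instant of `D` and a
sunset instant of `e` inside `[0, max T₁ 1]`, so the gap is `≤ max T₁ 1`, uniformly in `K`.
Hence the normal form loses nothing. -/
theorem gapBody_of_settlingBody {ν : ℝ} {g : ℤ³ → ℂ³} {E ε : ℝ} {M : ℕ} {B : ℝ}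
    (h : SettlingBody ν g E ε M B) : GapBody ν g E ε M B := by
  obtain ⟨T₁, E₁, ε₁, B₁, hE₁, hε₁, H⟩ := h
  refine ⟨max T₁ 1, (ε + ε₁) / 2, (E₁ + 2 * E) / 2, B₁, by linarith, by linarith,
    fun K S hS hprem => ?_⟩
  obtain ⟨c, hc, hball, hsettled⟩ := H K S hS hprem
  refine ⟨c, hc, hball, ?_⟩
  have hR0 : (0 : ℝ) ≤ max T₁ 1 := zero_le_one.trans (le_max_right _ _)
  obtain ⟨sD, hsD0, hsDR, hsun⟩ := rising_sun (a := (ε + ε₁) / 2) (t₀ := 0) (R := max T₁ 1)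
    le_rfl hR0 (continuousOn_resolvedDissipation ν M hc.2.1) (fun u hu => by
      have hu0 : 0 < u := one_pos.trans_le ((le_max_right _ _).trans hu)
      have h := (hsettled u ((le_max_left _ _).trans hu)).2
      rw [timeMean, le_inv_mul_iff₀ hu0] at h
      simp only [intervalIntegral.integral_same, mul_zero, sub_zero]
      nlinarith)
  obtain ⟨se, hse0, hseR, hset⟩ := setting_sun (b := (E₁ + 2 * E) / 2) (t₀ := 0) (R := max T₁ 1)
    le_rfl hR0 (continuousOn_modalEnergy hc.2.1) (fun u hu => by
      have hu0 : 0 < u := one_pos.trans_le ((le_max_right _ _).trans hu)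
      have h := (hsettled u ((le_max_left _ _).trans hu)).1
      rw [timeMean, inv_mul_le_iff₀ hu0] at h
      simp only [intervalIntegral.integral_same, mul_zero, sub_zero]
      nlinarith)
  refine ⟨sD, se, hsD0, hse0, ?_, hsun, hset⟩
  rw [abs_sub_le_iff]
  constructor <;> linarith

/-- **Normal form, fixed data**: settling ⟺ bounded sunrise–sunset gap. -/
theorem settlingBody_iff_gapBody {ν : ℝ} (hν : 0 < ν) {g : ℤ³ → ℂ³} {E ε : ℝ} {M : ℕ} {B : ℝ}
    (hε : 0 < ε) : SettlingBody ν g E ε M B ↔ GapBody ν g E ε M B :=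
  ⟨gapBody_of_settlingBody, settlingBody_of_gapBody hν hε⟩

/-- **Normal form of the stub**: `stub_uniformSettling ⟺ UniformSunriseGap` (all regimes,
including the degenerate `E ≤ 0`, where both sides are vacuous). -/
theorem stub_uniformSettling_iff_gap : Sig.stub_uniformSettling ↔ UniformSunriseGap :=
  ⟨fun h ν hν N g hg hsupp hg0 hdiv E ε M B hε =>
      gapBody_of_settlingBody (h ν hν N g hg hsupp hg0 hdiv E ε M B hε),
    stub_uniformSettling_of_gap⟩

/-! ### §6 Rungs -/

/-- **Rung 1 (energy slack, k2 R1 = k3 A(i)), PROVED.** If the ball already sits below `2E`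
(`B < 2E`; with the skeleton's `B = G²/(4π²ν)² + 1` this is the large-viscosity /
small-force regime `2E > G²/(4π²ν)² + 1`), the body holds with `T₁ = 1`: the energy mean is
`≤ B ≤ E₁ := (B + 2E)/2` on every window, and a sunrise instant of the resolved dissipation at
level `3ε/2` (which exists along the premise witness, `exists_sunrise`) does the rest. -/
theorem settlingBody_of_energySlack {ν : ℝ} (hν : 0 < ν) {g : ℤ³ → ℂ³} {E ε : ℝ} {M : ℕ}
    {B : ℝ} (hε : 0 < ε) (hslack : B < 2 * E) : SettlingBody ν g E ε M B := by
  refine ⟨1, (B + 2 * E) / 2, 5 * ε / 4, B, by linarith, by linarith, fun K S hS hprem => ?_⟩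
  obtain ⟨c, hc, hball, -, hDinf⟩ := hprem
  have he0 : ∀ t, 0 ≤ modalEnergy (c t) := fun t => modalEnergy_nonneg _
  have hB0 : 0 ≤ B := (he0 0).trans (hball 0 le_rfl)
  set C : ℝ := ν * (4 * Real.pi ^ 2 * ((M : ℝ) ^ 2 * B)) with hC
  have hDbd : ∀ t, 0 < t → |resolvedDissipation ν M (c t)| ≤ C := fun t ht => by
    rw [abs_of_nonneg (resolvedDissipation_nonneg hν.le M (c t))]
    refine (resolvedDissipation_le hν.le M (c t)).trans ?_
    simp only [hC]
    gcongr
    exact hball t ht.le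
  have ha : 3 * ε / 2 < longTimeAvgInf (fun t => resolvedDissipation ν M (c t)) := by linarith
  obtain ⟨s, hs0, hsun⟩ :=
    exists_sunrise (continuousOn_resolvedDissipation ν M hc.2.1) hDbd ha le_rfl
  refine ⟨fun t => c (t + s), hc.comp_add hs0, fun t ht => hball (t + s) (by linarith),
    fun T hT => ⟨?_, ?_⟩⟩
  · -- energy mean `≤ B ≤ (B + 2E)/2`
    have hT0 : 0 < T := one_pos.trans_le hT
    have hmean : |timeMean (fun t => modalEnergy (c (t + s))) T| ≤ B :=
      abs_timeMean_le hT0 fun t ht _ => by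
        rw [abs_of_nonneg (he0 _)]
        exact hball (t + s) (by linarith)
    linarith [(abs_le.1 hmean).2]
  · -- dissipation mean `≥ 3ε/2 ≥ 5ε/4`
    have hT0 : 0 < T := one_pos.trans_le hT
    show 5 * ε / 4 ≤ timeMean (fun t => resolvedDissipation ν M (c (t + s))) T
    rw [timeMean, integral_comp_add_right_zero (fun t => resolvedDissipation ν M (c t)) s T,
      le_inv_mul_iff₀ hT0]
    have := hsun T hT0.le
    nlinarith

/-- **Rung 1 at stub level**: the stub restricted to data with `B < 2E`. -/
theorem stub_uniformSettling_energySlack :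
    ∀ (ν : ℝ), 0 < ν → ∀ (N : ℕ) (g : ℤ³ → ℂ³), IsConjSymm g →
      (∀ k, k ∉ freqBall N → g k = 0) → g 0 = 0 →
      (∀ k : ℤ³, ∑ i, ((k i : ℤ) : ℂ) * g k i = 0) →
      ∀ (E ε : ℝ) (M : ℕ) (B : ℝ), 0 < ε → B < 2 * E → SettlingBody ν g E ε M B :=
  fun _ hν _ _ _ _ _ _ _ _ _ _ hε hslack => settlingBody_of_energySlack hν hε hslack

/-- **Rung 2 (steady limit, k1 C3 = k3 L2), typed.** If every ball trajectory of every truncation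
converges (no rate required!) to a zero of the Galerkin field, the body holds with the STEADY
witness and `T₁ = 1` — the cleanest demonstration that the stub's `∃`-trajectory freedom removes
waiting times. Hypothesis verifiable in the energy-stable / small-Grashof regime (k3 L1:
`Λ_N √B < 4π²ν`, K-uniform by `MomentParityGalerkinBounds.norm_convectionCoeff_le_of_sum_sq_le`).
Size M (needs a Cesàro lemma `Tendsto φ atTop (𝓝 l) → Tendsto (timeMean φ) atTop (𝓝 l)` for
bounded continuous `φ`, not in the tree). -/
def BallTrajectoriesSettle (ν : ℝ) (g : ℤ³ → ℂ³) (B : ℝ) : Prop :=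
  ∀ (K : ℕ) (S : Finset ℤ³), S = (freqBall K).erase 0 →
    ∀ c : ℝ → ↥S → ℂ³, IsCoeffTrajectory S ν g c → (∀ t, 0 ≤ t → modalEnergy (c t) ≤ B) →
      ∃ U : ↥S → ℂ³, U ∈ galerkinSubspace S ∧ galerkinRHS S ν (fun k => g k) U = 0 ∧
        Tendsto c atTop (𝓝 U)

/-- Rung 2 as an implication (to be proved by the lead if the regime rung is wanted). -/
def RungSteadyLimit : Prop :=
  ∀ (ν : ℝ), 0 < ν → ∀ (g : ℤ³ → ℂ³) (E ε : ℝ) (M : ℕ) (B : ℝ), 0 < ε →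
    BallTrajectoriesSettle ν g B → SettlingBody ν g E ε M B

/-- **Rung 3 (quiet-phase floor, k3 Q3), typed.** Along any ball trajectory, every window of
length `≥ T⋆` carries resolved dissipation `≥ d₀ · T`, with `(T⋆, d₀)` depending only on
`(ν, g, B, M)` through a forced mode `k₀` (`|k₀| ≤ N ≤ M`), not on `K`: integrate the `k₀`-mode
equation over the window, bound the convection term K-uniformly by
`2π|k₀| · e` (`MomentParityGalerkinBounds`), the energy by the resolved dissipation through the
energy identity, and conclude by Cauchy–Schwarz. Consequence: the stub for `ε < d₀`
(`T₁ = T⋆`, any sunset instant of `e`). Honest but tiny: `d₀ ~ ν³‖g k₀‖²/(|k₀| G)²`. Size M–L. -/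
def QuietPhaseFloor : Prop :=
  ∀ (ν : ℝ), 0 < ν → ∀ (N : ℕ) (g : ℤ³ → ℂ³), IsConjSymm g → (∀ k, k ∉ freqBall N → g k = 0) →
    g 0 = 0 → (∀ k : ℤ³, ∑ i, ((k i : ℤ) : ℂ) * g k i = 0) → (∃ k, g k ≠ 0) →
    ∀ (M : ℕ) (B : ℝ), N ≤ M →
      ∃ (Tstar d₀ : ℝ), 0 < d₀ ∧
        ∀ (K : ℕ) (S : Finset ℤ³), S = (freqBall K).erase 0 → N ≤ K →
          ∀ c : ℝ → ↥S → ℂ³, IsCoeffTrajectory S ν g c → (∀ t, 0 ≤ t → modalEnergy (c t) ≤ B) →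
            ∀ s T : ℝ, 0 ≤ s → Tstar ≤ T →
              d₀ * T ≤ ∫ t in s..(s + T), resolvedDissipation ν M (c t)

end Summit.AnomalousDissipation.AnomalousDissipation.Cruxes.UniformEquilibration.StubPlanSettling
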